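import Mathlib
import Summits.KontsevichZagierPeriods.Zeta5Search.Families.CubicalChartVIMLive
import Summits.KontsevichZagierPeriods.Zeta5Search.Families.CoeffAsympMain
import HarnessLib

/-!
# ζ(5) search — every LIVE balanced ray of Brown's `M_{0,10}` family has a growth exponent: a dual-cell variational number

HONEST FRAMING: systematic search; no irrationality claim unless certified.  Cell `pub-zeta5`, certifier 2 (cert-2 g10,
2026-08-22).  Real analysis of coefficients of powers of polynomials with non-negative coefficients; nothing about `ζ(5)` or
`ζ(7)`; no number of record moves; no conjecture node is used.

WHAT.  fam-brown9's general-exponent scan (Stage A (b), `HOME/families/brown9/STAGE-A-GENERAL.md`) reads a direction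
`d = (a; b)` of the VIM cone through the leading coefficients `A_n(d) = leading (n·a) (n·b)` and the MODEL growth `b̂(d)`
(Richardson extrapolation of an exact prefix).  By `Families/CubicalChartVIM` and the scale laws below, for a balanced pair
`A_n(d) = [g^{n·B(b)}] P_a^n` with ONE polynomial `P_a = vimSpanProd a` (non-negative coefficients) — so cert-2 g9's engine
(`Families/CoeffAsympMain.tendsto_log_coeff_pow_div`) applies to every LIVE balanced direction:
* `vimSpanProd_smul`, `vimGap_smul`, `balanced_smul` — scale laws along a ray;
* **`tendsto_log_leading_ray`**: for `Balanced a b` and `VIMLive a b`,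
  `log (leading (n·a) (n·b)) / n → log ⨅_{u ∈ ℝ⁸} Σ_α [g^α]P_a · e^{(α − B(b))·u}` — the growth exponent `b(d)` of every live
  balanced ray EXISTS and is the logarithm of the infimum over the positive orthant of the ray's dual-cell Laurent polynomial
  `P_a(g)/g^{B(b)}` (`vimRayRate a b`; the diagonal value is `log λ₄`, `Families/CubicalChartVIMDual`);
* `vimRayRate_arg_pos` (the infimum is positive: it is at least `leading a b ≥ 1`).
The identification of the infimum with an extremum of Brown's projective function on the closed dual cell (fam-brown9 g13's
oracle `μ(d)`) is the general-exponent analogue of `Families/CubicalChartVIMDual` and is NOT done here.  Standard axioms only.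
-/

noncomputable section

open Finset Real Filter Topology

namespace Summit.KontsevichZagierPeriods.Zeta5Search.Families.Cellular

namespace CubicalChartN

open Summit.KontsevichZagierPeriods.Zeta5Search.Cells.VanishingMiddleLeading (Balanced leading)

/-! ## Scale laws along a ray -/

/-- `P_{n·a} = P_a^n`. -/
theorem vimSpanProd_smul (n : ℕ) (a : Fin 10 → ℕ) : vimSpanProd (n • a) = vimSpanProd a ^ n := by
  unfold vimSpanProd
  simp only [Pi.smul_apply, smul_eq_mul, mul_pow, ← pow_mul, mul_comm n]

/-- `B(n·b) = n·B(b)`. -/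
theorem vimGap_smul (n : ℕ) (b : Fin 10 → ℕ) :
    Finsupp.equivFunOnFinite.symm (vimGap (n • b)) = n • Finsupp.equivFunOnFinite.symm (vimGap b) := by
  ext w
  simp only [Finsupp.coe_equivFunOnFinite_symm, Finsupp.coe_smul, Pi.smul_apply, smul_eq_mul]
  fin_cases w <;> simp [vimGap]

/-- Balance is preserved along a ray. -/
theorem balanced_smul (n : ℕ) {a b : Fin 10 → ℕ} (h : Balanced a b) : Balanced (n • a) (n • b) := by
  unfold Cells.VanishingMiddleLeading.Balanced at h ⊢
  obtain ⟨v1, v2, v3, v4, v5, v6, v7, v8, v9, v10⟩ := h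
  simp only [Pi.smul_apply, smul_eq_mul, ← mul_add, v1, v2, v3, v4, v5, v6, v7, v8, v9, v10, and_self]

/-! ## The growth exponent of a live balanced ray -/

/-- The ray polynomial with real coefficients. -/
def vimPolyRa (a : Fin 10 → ℕ) : MvPolynomial (Fin 8) ℝ := MvPolynomial.map (Int.castRingHom ℝ) (vimSpanProd a)

/-- **`A_n(d) = [g^{n·B}] P_a^n`** for a balanced direction `d = (a; b)`. -/
theorem leading_ray_eq_coeff_pow {a b : Fin 10 → ℕ} (h : Balanced a b) (n : ℕ) :
    (leading (n • a) (n • b) : ℝ) =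
      MvPolynomial.coeff (n • Finsupp.equivFunOnFinite.symm (vimGap b)) (vimPolyRa a ^ n) := by
  rw [leading_eq_vimDualCT _ _ (balanced_smul n h), vimDualCT, vimGap_smul, vimSpanProd_smul, vimPolyRa, ← map_pow,
    MvPolynomial.coeff_map]
  simp

/-- `P_a` has non-negative real coefficients. -/
theorem coeff_vimPolyRa_nonneg (a : Fin 10 → ℕ) (m : Fin 8 →₀ ℕ) : 0 ≤ MvPolynomial.coeff m (vimPolyRa a) := by
  rw [vimPolyRa, MvPolynomial.coeff_map, vimSpanProd_eq_spanProd, eq_intCast]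
  exact_mod_cast SpanHall.coeff_spanProd_nonneg vimSpan _ m

/-- On a live balanced direction `[g^{B}] P_a = leading a b ≠ 0`. -/
theorem coeff_vimPolyRa_ne_zero {a b : Fin 10 → ℕ} (h : Balanced a b) (hl : VIMLive a b) :
    MvPolynomial.coeff (Finsupp.equivFunOnFinite.symm (vimGap b)) (vimPolyRa a) ≠ 0 := by
  have h1 := leading_ray_eq_coeff_pow h 1
  rw [pow_one, one_smul, one_smul, one_smul] at h1
  rw [← h1]
  exact_mod_cast (leading_ne_zero_iff_live a b h).2 hl

/-- **The growth exponent of the ray** `d = (a; b)`: `log ⨅_u Σ_α [g^α]P_a e^{(α−B)·u}`. -/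
def vimRayRate (a b : Fin 10 → ℕ) : ℝ :=
  Real.log (⨅ u : Fin 8 → ℝ, CoeffAsymp.tilt (vimPolyRa a).support (fun m => MvPolynomial.coeff m (vimPolyRa a))
    (Finsupp.equivFunOnFinite.symm (vimGap b)) u)

/-- **Every live balanced ray has a growth exponent**: `log A_n(d) / n → vimRayRate a b`. -/
theorem tendsto_log_leading_ray {a b : Fin 10 → ℕ} (h : Balanced a b) (hl : VIMLive a b) :
    Tendsto (fun n : ℕ => Real.log (leading (n • a) (n • b) : ℝ) / n) atTop (𝓝 (vimRayRate a b)) := by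
  have hmain := CoeffAsymp.tendsto_log_coeff_pow_div (vimPolyRa a) (coeff_vimPolyRa_nonneg a)
    (coeff_vimPolyRa_ne_zero h hl)
  unfold vimRayRate
  refine Tendsto.congr (fun n => ?_) hmain
  rw [leading_ray_eq_coeff_pow h]

/-- The infimum is positive (so `vimRayRate` is the logarithm of a positive number). -/
theorem vimRayRate_arg_pos {a b : Fin 10 → ℕ} (h : Balanced a b) (hl : VIMLive a b) :
    0 < ⨅ u : Fin 8 → ℝ, CoeffAsymp.tilt (vimPolyRa a).support (fun m => MvPolynomial.coeff m (vimPolyRa a))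
      (Finsupp.equivFunOnFinite.symm (vimGap b)) u := by
  have hc : ∀ m ∈ (vimPolyRa a).support, 0 < MvPolynomial.coeff m (vimPolyRa a) := fun m hm =>
    lt_of_le_of_ne (coeff_vimPolyRa_nonneg a m) (Ne.symm (MvPolynomial.mem_support_iff.1 hm))
  exact CoeffAsymp.iInf_tilt_pos hc (MvPolynomial.mem_support_iff.2 (coeff_vimPolyRa_ne_zero h hl))

end CubicalChartN

end Summit.KontsevichZagierPeriods.Zeta5Search.Families.Cellular
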